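import Literature.IUT.HodgeArakelov.ThetaEnvDataRecordModelKummerOfTower
import Literature.IUT.HodgeArakelov.ModelCyclotomesZHat
import Literature.IUT.HodgeArakelov.MonoThetaProjectiveThetaEnvProofs
import Literature.AnabelianGeometry.EtaleTheta.Discharge.Sec1ThetaCompactOfYcl

/-!
# [IUTchII] Prop. 3.1 (ii) at the genuine record over `Π = Π^tp_X̲̲`, constants `ℚ̄_pˣ ⊇ O` through `ε`: the three
# GAP binders `hZ` (G-w4d021-1), `hlim` (G-w4d030-2), `hΔ` (G-w5d187-1) SUPPLIED — proof-only knit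

Proof-only companion (abc-iut cell, K-L6 slice, seat abc-iut-L6-d3 gen 6; layer L6; node **IUTchII:Prop3.1(ii)**, sub-DAG
`plan/L6/SUBDAG-IUTchII-Prop-31-33-34.md` junction J4; GAP-LEDGER rows G-w4d021-1 / G-w4d030-2 / D-G-w5d187-1 06:20:30Z
«remaining hΔ-consumers of other lineages (… ThetaEnvDataRecordModelKummerOfTower) re-point by the same two lines») to
abc-iut-w4-d007's `ThetaEnvDataRecordModelKummerOfTower.lean` (p425448: **`EtaleLevels.prop31ii_thetaEnvRecordKummer_of_cyclotomeTower`**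
— [IUTchII] Prop. 3.1 (ii), BOTH printed clauses, at abc-iut-w4-d019's genuine record `thetaEnvRecordKummer` with the constants
`ℚ̄_pˣ ⊇ O` acted on through `ε`, the input `hinj` and the coefficient datum `c` already discharged there).  That theorem still
binds three hypotheses which the tree PROVES from print-shaped inputs:
* `hZ : ∀ M, Nonempty ((l·Δ_Θ)(𝕄_M) ≃* Ẑ)` («`Δ_Θ ≅ Ẑ(1)`», [EtTh] p. 12) — abc-iut-L2-d1's
  `ModelCyclotomes.nonempty_lDeltaQuot_rigidData_mulEquiv_zHat` (p415192) from `IsEtThOrigin` + `hYcl`;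
* `hlim : Function.Bijective rigidLimHom` («`(l·Δ_Θ)(M^Θ_*) ⥲ Π_μ(M^Θ_*)`», [IUTchII] Prop. 1.5 (iii)) — abc-iut-w4-d030's
  `EtaleLevels.bijective_rigidLimHom` (p416249) from `hZ` alone;
* `hΔ : IsCompact Δ_Θ` («abelian profinite», [EtTh] p. 12) — abc-iut-w5-d111's
  `ThetaSetting.isCompact_deltaTheta_of_groupLevelData` (p425959) from `hYcl` + the [SemiAnbd] §6 group-level data of `Π^tp_X`.
This file composes them: the two named suppliers `nonempty_lDeltaQuot_zHat_of_origin`, `bijective_rigidLimHom_of_origin` and the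
re-pointed statement **`EtaleLevels.prop31ii_thetaEnvRecordKummer_of_origin`**, whose binders are EXACTLY: the natural-system DATA
(`C`, `mods`/`hmods`, `f`/`hf`, `L`, `O`/`hO`, `ι₀`), the predicates `Compat`/`Sec2Hyps`/`PiYddCharacteristic`, the named facts
`Prop15iii` (F-0591) / `IsEtThOrigin` (F-2498), the closedness hypothesis `hYcl` (G-w4d021-2, «the image of `Δ^tp_Y` in `Δ^Θ_X` is
closed») and one `GroupLevelData` of the tempered curve — no `hZ`, no `hlim`, no `hΔ`, no `hinj`, no free `c`.  No definitions; nothing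
of another seat's file is edited or restated (the conclusion is p425448's, verbatim, at the supplied proofs).

S. Mochizuki, *Inter-universal Teichmüller theory II*, kurims manuscript (Dec. 2020), Prop. 3.1 (ii) p. 88: "`Ψ_cns(M^Θ_*) :=
M_TM(M^Θ_*) ⊆ lim_J H¹(Π_Ÿ(M^Θ_*)|_J, Π_μ(M^Θ_*))` … a 'monoid of constants' — i.e., which is naturally isomorphic to `O^▷_{F̄_v}`
… — equipped with a natural conjugation action by `Π_X(M^Θ_*)`" [cite: Mochizuki2012, Prop 3.1 (ii) p.88]; S. Mochizuki, *The étale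
theta function …*, Publ. RIMS **45** (2009) §1 p. 12 («a natural exact sequence of abelian profinite groups
`1 → Δ_Θ → (Δ^tp_Y)^Θ → (Δ^tp_Y)^ell → 1`») [cite: MochizukiEtTh2009, §1 p.12].  Claim key `Mochizuki2012` (D-0012, DISPUTED);
nothing here takes a side on [IUTchIII] Cor. 3.12; typed ≠ proved for the residual inputs; instantiated ≠ endorsed.
-/

noncomputable section

namespace Literature.IUT.HodgeArakelov

open Literature.AnabelianGeometry.EtaleTheta CohomologySystemOfContH1 EtaleThetaDataOfSetting

namespace EtaleLevels

variable {p : ℕ} [Fact p.Prime] {D : Literature.AnabelianGeometry.EtaleTheta.ThetaSetting p}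
  {E : D.EtaleThetaData} {l : ℕ} (C : E.DoubleUnderline l) (hC : D.Compat) (hS : D.Sec2Hyps)
  (hl : l.Prime) (hp2 : p ≠ 2) (hpl : p ≠ l) (hζ : ∃ ζ : D.K, IsPrimitiveRoot ζ (4 * l))
  (mods : ∀ M : ℕ+, D.CyclotomeMod l M)
  (f : contCocycles D.toTheta D.DeltaTheta C.GtpYdduu) (hf : f ∈ C.rootCocycles hC)
  (hmods : ∀ (M M' : ℕ+) (h : (M : ℕ) ∣ (M' : ℕ)) (x : D.lDeltaTheta l),
    MuN.red p M M' h ((mods M').red x) = (mods M).red x)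
  (h15 : Literature.AnabelianGeometry.EtaleTheta.ThetaSetting.Prop15iii E hC) (L : C.CuspLabels)
  (hO' : D.IsEtThOrigin)
  (hYcl : (D.DtpY.map D.toHat.toMonoidHom).topologicalClosure ≤
    D.DtpY.map D.toHat.toMonoidHom ⊔ (⁅⁅D.DeltaHat, D.DeltaHat⁆, D.DeltaHat⁆).topologicalClosure)

/-- **`hZ` of the natural system from the origin clauses**: «`(l·Δ_Θ)(𝕄_M) ≅ Ẑ`» at EVERY level `M`, for the [EtTh]
model rigid data `C.rigidData (mods M) …` — abc-iut-L2-d1's `ModelCyclotomes.nonempty_lDeltaQuot_rigidData_mulEquiv_zHat`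
(from `IsEtThOrigin`, `hYcl`, `l ≠ 0`) in the `∀ M`-shape bound by abc-iut-w4-d030's natural projective system.
[cite: MochizukiEtTh2009, §1 p.12] -/
theorem nonempty_lDeltaQuot_zHat_of_origin (hl : l.Prime) (hO' : D.IsEtThOrigin)
    (hYcl : (D.DtpY.map D.toHat.toMonoidHom).topologicalClosure ≤
      D.DtpY.map D.toHat.toMonoidHom ⊔ (⁅⁅D.DeltaHat, D.DeltaHat⁆, D.DeltaHat⁆).topologicalClosure) :
    ∀ M : ℕ+, Nonempty (ModelCyclotomes.lDeltaQuot (C.rigidData (mods M) hC hS h15 L) ≃*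
      Literature.IUT.HodgeTheaters.ZHat) :=
  fun M => ModelCyclotomes.nonempty_lDeltaQuot_rigidData_mulEquiv_zHat C (mods M) hC hS h15 L hO' hYcl hl.ne_zero

/-- **`hlim` of the natural system from the origin clauses**: the limit cyclotomic rigidity map
`(l·Δ_Θ)(𝕄_*) → Π_μ(𝕄_*)` of [IUTchII] Prop. 1.5 (iii) is bijective — abc-iut-w4-d030's `bijective_rigidLimHom` at the `hZ`
just supplied. [claim: Mochizuki2012, status: disputed] (IUTchII §1 Prop 1.5 (iii), kurims p.29) -/
theorem bijective_rigidLimHom_of_origin :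
    Function.Bijective (rigidLimHom C hC hS hl hp2 hpl hζ mods f hf hmods h15 L
      (nonempty_lDeltaQuot_zHat_of_origin C hC hS mods h15 L hl hO' hYcl)) :=
  bijective_rigidLimHom C hC hS hl hp2 hpl hζ mods f hf hmods h15 L _

variable (hcharY : EtaleThetaDataOfSetting.PiYddCharacteristic C) [(EtaleThetaDataOfSetting.PiYdd C).Normal]
  (O : Submonoid (PadicAlgCl p)ˣ) (hO : ∀ (σ : Pi C) (b : (PadicAlgCl p)ˣ), b ∈ O → σ • b ∈ O) (ι₀ : Pi C)
  (d : D.GroupLevelData)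

include hO d in
/-- **[IUTchII] Prop. 3.1 (ii) at the genuine record, constants `ℚ̄_pˣ ⊇ O` through `ε` — `hZ`, `hlim`, `hΔ`, `hinj`, `c` ALL
SUPPLIED.**  For abc-iut-w4-d019's genuine record `thetaEnvRecordKummer` of the natural system (taken at the PROVED `hZ`/`hlim`
above) there is a BIJECTIVE change of coefficient cyclotome `c : Λ(ℚ̄_pˣ) = Ẑ(1) ⥲ l·Δ_Θ`, inverse to the model's identifications
(`(mods M).red (c ζ) = ζ_M`), such that: `Ψ_cns := κ(O)` is conjugation-stable; there is an isomorphism `O ⥲ Ψ_cns` which IS the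
Kummer map `κ = h1LimKummerOn c … O` on elements, INTERTWINES the Galois action through `ε` on `O` with the conjugation action
`h1LimConjMulAut`, and is UNIQUE as such; and `κ(x) ∈ M^×_TM ↔ IsUnit x` — abc-iut-w4-d007's
`prop31ii_thetaEnvRecordKummer_of_cyclotomeTower` (p425448) with `hΔ := ThetaSetting.isCompact_deltaTheta_of_groupLevelData d hYcl`
(abc-iut-w5-d111, p425959).  Residual inputs, BY NAME: the natural-system data, `Compat`, `Sec2Hyps`, `PiYddCharacteristic`,
`Prop15iii` (F-0591), `IsEtThOrigin` (F-2498), `hYcl` (G-w4d021-2), the [SemiAnbd] §6 `GroupLevelData` of `Π^tp_X`, and the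
numeric side conditions of [IUTchI] Def. 3.1. [claim: Mochizuki2012, status: disputed] (IUTchII §3 Prop 3.1 (ii), kurims p.88) -/
theorem prop31ii_thetaEnvRecordKummer_of_origin :
    ∃ c : CyclotomeCoefficients (phi C) (D.lDeltaTheta l) (PadicAlgCl p)ˣ,
      Function.Bijective c.hom ∧
      (∀ (ζ : Literature.AnabelianGeometry.EtaleTheta.cyclotome (PadicAlgCl p)ˣ) (M : ℕ+),
        (((mods M).red (c.hom ζ) : MuN p M) : (PadicAlgCl p)ˣ) = (ζ : ℕ+ → (PadicAlgCl p)ˣ) M) ∧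
      ((thetaEnvRecordKummer C hC hS hl hp2 hpl hζ mods f hf hmods h15 L
              (nonempty_lDeltaQuot_zHat_of_origin C hC hS mods h15 L hl hO' hYcl) hcharY
              (bijective_rigidLimHom_of_origin C hC hS hl hp2 hpl hζ mods f hf hmods h15 L hO' hYcl) c (isOpen_stabilizer_units C)
            (finiteIndex_stabilizer_units C) O ι₀).IsConjStable
          (thetaEnvRecordKummer C hC hS hl hp2 hpl hζ mods f hf hmods h15 L
              (nonempty_lDeltaQuot_zHat_of_origin C hC hS mods h15 L hl hO' hYcl) hcharY
              (bijective_rigidLimHom_of_origin C hC hS hl hp2 hpl hζ mods f hf hmods h15 L hO' hYcl) c (isOpen_stabilizer_units C)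
            (finiteIndex_stabilizer_units C) O ι₀).constantMonoid ∧
        (∃ e : O ≃*
            (thetaEnvRecordKummer C hC hS hl hp2 hpl hζ mods f hf hmods h15 L
              (nonempty_lDeltaQuot_zHat_of_origin C hC hS mods h15 L hl hO' hYcl) hcharY
              (bijective_rigidLimHom_of_origin C hC hS hl hp2 hpl hζ mods f hf hmods h15 L hO' hYcl) c (isOpen_stabilizer_units C)
              (finiteIndex_stabilizer_units C) O ι₀).constantMonoid,
          (∀ x : O, ((e x : (thetaEnvRecordKummer C hC hS hl hp2 hpl hζ mods f hf hmods h15 L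
              (nonempty_lDeltaQuot_zHat_of_origin C hC hS mods h15 L hl hO' hYcl) hcharY
              (bijective_rigidLimHom_of_origin C hC hS hl hp2 hpl hζ mods f hf hmods h15 L hO' hYcl) c
                (isOpen_stabilizer_units C) (finiteIndex_stabilizer_units C) O ι₀).constantMonoid) :
              (thetaEnvRecordKummer C hC hS hl hp2 hpl hζ mods f hf hmods h15 L
              (nonempty_lDeltaQuot_zHat_of_origin C hC hS mods h15 L hl hO' hYcl) hcharY
              (bijective_rigidLimHom_of_origin C hC hS hl hp2 hpl hζ mods f hf hmods h15 L hO' hYcl) c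
                (isOpen_stabilizer_units C) (finiteIndex_stabilizer_units C) O ι₀).H) =
              h1LimKummerOn (phi C) (D.lDeltaTheta l) (PiYdd C) c (isOpen_stabilizer_units C)
                (finiteIndex_stabilizer_units C) O x) ∧
          (∀ (g : Pi C) (x : O),
            ((e ⟨g • (x : (PadicAlgCl p)ˣ), hO g x x.2⟩ : (thetaEnvRecordKummer C hC hS hl hp2 hpl hζ mods f hf hmods h15 L
                (nonempty_lDeltaQuot_zHat_of_origin C hC hS mods h15 L hl hO' hYcl) hcharY
                (bijective_rigidLimHom_of_origin C hC hS hl hp2 hpl hζ mods f hf hmods h15 L hO' hYcl) c (isOpen_stabilizer_units C) (finiteIndex_stabilizer_units C) O ι₀).constantMonoid) :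
                (thetaEnvRecordKummer C hC hS hl hp2 hpl hζ mods f hf hmods h15 L
              (nonempty_lDeltaQuot_zHat_of_origin C hC hS mods h15 L hl hO' hYcl) hcharY
              (bijective_rigidLimHom_of_origin C hC hS hl hp2 hpl hζ mods f hf hmods h15 L hO' hYcl) c
                  (isOpen_stabilizer_units C) (finiteIndex_stabilizer_units C) O ι₀).H) =
              h1LimConjMulAut (phi C) (D.lDeltaTheta l) (PiYdd C) g
                ((e x : (thetaEnvRecordKummer C hC hS hl hp2 hpl hζ mods f hf hmods h15 L
              (nonempty_lDeltaQuot_zHat_of_origin C hC hS mods h15 L hl hO' hYcl) hcharY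
              (bijective_rigidLimHom_of_origin C hC hS hl hp2 hpl hζ mods f hf hmods h15 L hO' hYcl) c
                  (isOpen_stabilizer_units C) (finiteIndex_stabilizer_units C) O ι₀).constantMonoid) :
                  (thetaEnvRecordKummer C hC hS hl hp2 hpl hζ mods f hf hmods h15 L
              (nonempty_lDeltaQuot_zHat_of_origin C hC hS mods h15 L hl hO' hYcl) hcharY
              (bijective_rigidLimHom_of_origin C hC hS hl hp2 hpl hζ mods f hf hmods h15 L hO' hYcl) c
                    (isOpen_stabilizer_units C) (finiteIndex_stabilizer_units C) O ι₀).H)) ∧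
          (∀ e' : O ≃*
              (thetaEnvRecordKummer C hC hS hl hp2 hpl hζ mods f hf hmods h15 L
              (nonempty_lDeltaQuot_zHat_of_origin C hC hS mods h15 L hl hO' hYcl) hcharY
              (bijective_rigidLimHom_of_origin C hC hS hl hp2 hpl hζ mods f hf hmods h15 L hO' hYcl) c (isOpen_stabilizer_units C)
                (finiteIndex_stabilizer_units C) O ι₀).constantMonoid,
            (∀ x : O, ((e' x : (thetaEnvRecordKummer C hC hS hl hp2 hpl hζ mods f hf hmods h15 L
              (nonempty_lDeltaQuot_zHat_of_origin C hC hS mods h15 L hl hO' hYcl) hcharY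
              (bijective_rigidLimHom_of_origin C hC hS hl hp2 hpl hζ mods f hf hmods h15 L hO' hYcl) c
                  (isOpen_stabilizer_units C) (finiteIndex_stabilizer_units C) O ι₀).constantMonoid) :
                (thetaEnvRecordKummer C hC hS hl hp2 hpl hζ mods f hf hmods h15 L
              (nonempty_lDeltaQuot_zHat_of_origin C hC hS mods h15 L hl hO' hYcl) hcharY
              (bijective_rigidLimHom_of_origin C hC hS hl hp2 hpl hζ mods f hf hmods h15 L hO' hYcl) c
                  (isOpen_stabilizer_units C) (finiteIndex_stabilizer_units C) O ι₀).H) =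
                h1LimKummerOn (phi C) (D.lDeltaTheta l) (PiYdd C) c (isOpen_stabilizer_units C)
                  (finiteIndex_stabilizer_units C) O x) → e' = e)) ∧
        (∀ x : O, h1LimKummerOn (phi C) (D.lDeltaTheta l) (PiYdd C) c (isOpen_stabilizer_units C)
              (finiteIndex_stabilizer_units C) O x ∈
            (thetaEnvRecordKummer C hC hS hl hp2 hpl hζ mods f hf hmods h15 L
              (nonempty_lDeltaQuot_zHat_of_origin C hC hS mods h15 L hl hO' hYcl) hcharY
              (bijective_rigidLimHom_of_origin C hC hS hl hp2 hpl hζ mods f hf hmods h15 L hO' hYcl) c (isOpen_stabilizer_units C)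
              (finiteIndex_stabilizer_units C) O ι₀).units ↔
          IsUnit x)) :=
  prop31ii_thetaEnvRecordKummer_of_cyclotomeTower C hC hS hl hp2 hpl hζ mods f hf hmods h15 L
    (nonempty_lDeltaQuot_zHat_of_origin C hC hS mods h15 L hl hO' hYcl) hcharY
    (bijective_rigidLimHom_of_origin C hC hS hl hp2 hpl hζ mods f hf hmods h15 L hO' hYcl) O hO ι₀ hO'
    (Literature.AnabelianGeometry.EtaleTheta.ThetaSetting.isCompact_deltaTheta_of_groupLevelData D d hYcl)

end EtaleLevels

end Literature.IUT.HodgeArakelov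

end
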